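import Mathlib
import Summits.Ventures.HodgeRepro.Tier4.Target
import Summits.Ventures.HodgeRepro.Tier4.Common.TargetBall
import Summits.Ventures.HodgeRepro.Tier4.Common.TargetCalculus
import Summits.Ventures.HodgeRepro.Tier4.Common.TargetJacobian
import Summits.Ventures.HodgeRepro.Tier4.Common.AutForms
import Summits.Ventures.HodgeRepro.Tier4.Line3.BallChangeOfVariables

/-!
# Tier4/Line3/DomainTransfer — tiling the ball by the translates of a fundamental domain (transfer R6, part 1)

Blind re-derivation cell `pub-hodge-repro`, Tier 4 «PROVE THE STEP» (README §9–§10), LINE L3, seat t4-L3-p1 (prover);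
support module (S3) of L3.6a `term_main_unfold` (lead S12253), plan-3's transfer R6 (S12250 (3)), shared with L3.4 / L3.5.
Mathlib-level: nothing of the line's data enters.

SETTING.  `Γ′` a congruence subgroup of `U(H)` (`IsCongruenceSubgroup c H Γ′`, Target.lean §B), `C` a Sylvester matrix
(`IsSylvester (H.map τ₀) C`) and `τ₀ ∘ c = conj ∘ τ₀` (for the CM conjugation: typer-2's `complexConj_intertwines`);
`ballActions τ₀ C Γ′ = {actM (toBallMat τ₀ C γ) | γ ∈ Γ′}` the set of maps through which `Γ′` acts on the ball.

CONTENT.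
* `mem_unitaryJ_of_mem`: every `γ ∈ Γ′` has `M(γ) := toBallMat τ₀ C γ ∈ U(2,1)` (typer-2's `toBallMat_J`); hence every
  `φ ∈ ballActions τ₀ C Γ′` is a bijection of the ball with inverse in `ballActions τ₀ C Γ′` (`exists_inv_ballActions`).
* `integral_image_actM`: the change of variables on a measurable `D ⊆ 𝔹`:
  `∫ w in actM M '' D, g w = ∫ z in D, |det Jac(actM M)(z)|² · g (actM M z)` (`M ∈ U(2,1)`).
* **THE TILING** (`integral_ball_eq_tsum_image`): for `IsFundamentalDomainFor (ballActions τ₀ C Γ′) D` and `G` integrable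
  on the ball, `∫_𝔹 G = Σ'_{φ ∈ ballActions τ₀ C Γ′} ∫_{φ(D)} G` — the translates `φ(D)` are measurable (`actM M` is a
  measurable embedding of the ball), almost disjoint (the `IsFundamentalDomainFor` clause) and cover the ball up to a null
  set (a.e. `z` has some `φ z ∈ D`, so `z = ψ (φ z) ∈ ψ(D)` for the inverse `ψ`); `ballActions τ₀ C Γ′` is countable
  (`E` is a number field, so countable, and `Γ′` is a set of `3×3` matrices over `E`).
* `integral_ball_eq_tsum_domain`: the same with each tile pulled back to `D`:
  `∫_𝔹 G = Σ'_φ ∫_D |det Jac φ|² · G ∘ φ`.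

Nothing here asserts anything about the truth of (P); HC_CM is NOT proved by anyone in this repository.
-/

set_option autoImplicit false

noncomputable section

namespace Summit.Ventures.HodgeRepro.Tier4.Line3

open Summit.Ventures.HodgeRepro.Tier4
open Matrix MeasureTheory
open scoped ComplexConjugate

/-! ## 1. The maps of `ballActions` are `U(2,1)`-actions with inverses -/

section Actions

variable {E : Type*} [Field E] {c : E ≃+* E} {H : Matrix (Fin 3) (Fin 3) E} {τ₀ : E →+* ℂ}
  {C : Matrix (Fin 3) (Fin 3) ℂ} {Γ' : Set (Matrix (Fin 3) (Fin 3) E)}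

/-- Every element of a congruence subgroup is unitary for `H`. -/
theorem isUnitaryOf_of_mem_congruence (hΓ : IsCongruenceSubgroup c H Γ') {γ : Matrix (Fin 3) (Fin 3) E}
    (hγ : γ ∈ Γ') : IsUnitaryOf c H γ :=
  (hΓ.2.2.2.1 hγ).1

/-- `M(γ) ∈ U(2,1)` for `γ ∈ Γ′`. -/
theorem toBallMat_unitaryJ (hΓ : IsCongruenceSubgroup c H Γ') (hτ : ∀ x, τ₀ (c x) = conj (τ₀ x))
    (hC : IsSylvester (H.map τ₀) C) {γ : Matrix (Fin 3) (Fin 3) E} (hγ : γ ∈ Γ') :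
    (toBallMat τ₀ C γ)ᴴ * J * toBallMat τ₀ C γ = J :=
  toBallMat_J τ₀ c hτ hC (isUnitaryOf_of_mem_congruence hΓ hγ)

/-- Every map of `ballActions τ₀ C Γ′` is `actM M` for some `M ∈ U(2,1)`. -/
theorem exists_unitaryJ_of_mem_ballActions (hΓ : IsCongruenceSubgroup c H Γ') (hτ : ∀ x, τ₀ (c x) = conj (τ₀ x))
    (hC : IsSylvester (H.map τ₀) C) {φ : (Fin 2 → ℂ) → (Fin 2 → ℂ)} (hφ : φ ∈ ballActions τ₀ C Γ') :
    ∃ M : Matrix (Fin 3) (Fin 3) ℂ, Mᴴ * J * M = J ∧ φ = actM M := by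
  obtain ⟨γ, hγ, rfl⟩ := hφ
  exact ⟨toBallMat τ₀ C γ, toBallMat_unitaryJ hΓ hτ hC hγ, rfl⟩

/-- Every map of `ballActions τ₀ C Γ′` has an inverse on the ball in `ballActions τ₀ C Γ′`. -/
theorem exists_inv_ballActions (hΓ : IsCongruenceSubgroup c H Γ') (hτ : ∀ x, τ₀ (c x) = conj (τ₀ x))
    (hC : IsSylvester (H.map τ₀) C) {φ : (Fin 2 → ℂ) → (Fin 2 → ℂ)} (hφ : φ ∈ ballActions τ₀ C Γ') :
    ∃ ψ ∈ ballActions τ₀ C Γ', ∀ z ∈ ball, ψ (φ z) = z := by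
  obtain ⟨γ, hγ, rfl⟩ := hφ
  obtain ⟨γ', hγ', hγγ'⟩ := hΓ.2.2.1 γ hγ
  refine ⟨actM (toBallMat τ₀ C γ'), ⟨γ', hγ', rfl⟩, fun z hz => ?_⟩
  have hM := toBallMat_unitaryJ hΓ hτ hC hγ
  have hγ'γ : γ' * γ = 1 := mul_eq_one_comm.mp hγγ'
  rw [← actM_mul hM hz, ← toBallMat_mul τ₀ hC.1, hγ'γ, toBallMat_one τ₀ hC.1, actM_one']

end Actions

/-! ## 2. Change of variables on a measurable subset of the ball -/

section Image

variable {M : Matrix (Fin 3) (Fin 3) ℂ}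

/-- `actM M` (`M ∈ U(2,1)`) restricted to the ball is a measurable embedding. -/
theorem measurableEmbedding_actM (hM : Mᴴ * J * M = J) :
    MeasurableEmbedding (ball.restrict (actM M)) := by
  have hdiff : ∀ z ∈ ball, DifferentiableAt ℂ (actM M) z := fun z hz =>
    (differentiableOn_actM hM).differentiableAt (isOpen_ball.mem_nhds hz)
  exact measurableEmbedding_of_fderivWithin isOpen_ball.measurableSet
    (fun z hz => ((hdiff z hz).hasFDerivAt.restrictScalars ℝ).hasFDerivWithinAt) (actM_injOn_ball hM)

/-- The image of a measurable `D ⊆ 𝔹` under `actM M` (`M ∈ U(2,1)`) is measurable. -/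
theorem measurableSet_image_actM (hM : Mᴴ * J * M = J) {D : Set (Fin 2 → ℂ)} (hD : MeasurableSet D)
    (hDb : D ⊆ ball) : MeasurableSet (actM M '' D) := by
  have h : actM M '' D = ball.restrict (actM M) '' (Subtype.val ⁻¹' D) := by
    rw [Set.image_restrict, Set.inter_eq_left.mpr hDb]
  rw [h, (measurableEmbedding_actM hM).measurableSet_image]
  exact measurable_subtype_coe hD

/-- **CHANGE OF VARIABLES on a measurable `D ⊆ 𝔹`** (`M ∈ U(2,1)`). -/
theorem integral_image_actM (hM : Mᴴ * J * M = J) {D : Set (Fin 2 → ℂ)} (hD : MeasurableSet D) (hDb : D ⊆ ball)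
    (g : (Fin 2 → ℂ) → ℂ) :
    ∫ w in actM M '' D, g w = ∫ z in D, (Complex.normSq (jacDetMap (actM M) z) : ℂ) * g (actM M z) := by
  have hdiff : ∀ z ∈ D, DifferentiableAt ℂ (actM M) z := fun z hz =>
    (differentiableOn_actM hM).differentiableAt (isOpen_ball.mem_nhds (hDb hz))
  have hf' : ∀ z ∈ D, HasFDerivWithinAt (actM M) ((fderiv ℂ (actM M) z).restrictScalars ℝ) D z :=
    fun z hz => ((hdiff z hz).hasFDerivAt.restrictScalars ℝ).hasFDerivWithinAt
  rw [integral_image_eq_integral_abs_det_fderiv_smul (μ := volume) hD hf' ((actM_injOn_ball hM).mono hDb) g]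
  refine setIntegral_congr_fun hD fun z hz => ?_
  rw [det_restrictScalars_fderiv (hdiff z hz), abs_of_nonneg (Complex.normSq_nonneg _), Complex.real_smul]

end Image

/-! ## 3. The tiling -/

section Tiling

variable {E : Type*} [Field E] {c : E ≃+* E} {H : Matrix (Fin 3) (Fin 3) E} {τ₀ : E →+* ℂ}
  {C : Matrix (Fin 3) (Fin 3) ℂ} {Γ' : Set (Matrix (Fin 3) (Fin 3) E)}

/-- A number field is countable, hence so is any set of `3×3` matrices over it. -/
theorem countable_ballActions [NumberField E] : Countable (ballActions τ₀ C Γ') := by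
  haveI : Countable E := Finsupp.Countable.of_moduleFinite (R := ℚ)
  haveI : Countable (Matrix (Fin 3) (Fin 3) E) := inferInstanceAs (Countable (Fin 3 → Fin 3 → E))
  exact ((Set.to_countable Γ').image _).to_subtype

/-- The translates of `D ⊆ 𝔹` by `ballActions` lie in the ball. -/
theorem image_subset_ball (hΓ : IsCongruenceSubgroup c H Γ') (hτ : ∀ x, τ₀ (c x) = conj (τ₀ x))
    (hC : IsSylvester (H.map τ₀) C) {φ : (Fin 2 → ℂ) → (Fin 2 → ℂ)} (hφ : φ ∈ ballActions τ₀ C Γ')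
    {D : Set (Fin 2 → ℂ)} (hDb : D ⊆ ball) : φ '' D ⊆ ball := by
  obtain ⟨M, hM, rfl⟩ := exists_unitaryJ_of_mem_ballActions hΓ hτ hC hφ
  rintro _ ⟨z, hz, rfl⟩
  exact actM_mem_ball hM (hDb hz)

/-- Almost every point of the ball lies in some translate `φ(D)`, `φ ∈ ballActions τ₀ C Γ′`. -/
theorem ae_mem_iUnion_image (hΓ : IsCongruenceSubgroup c H Γ') (hτ : ∀ x, τ₀ (c x) = conj (τ₀ x))
    (hC : IsSylvester (H.map τ₀) C) {D : Set (Fin 2 → ℂ)} (hD : IsFundamentalDomainFor (ballActions τ₀ C Γ') D) :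
    ∀ᵐ z ∂(volume.restrict ball), z ∈ ⋃ φ : ballActions τ₀ C Γ', φ.1 '' D := by
  filter_upwards [hD.2.2.1, ae_restrict_mem isOpen_ball.measurableSet] with z hz hzb
  obtain ⟨φ, hφ, hφz⟩ := hz
  obtain ⟨ψ, hψ, hψφ⟩ := exists_inv_ballActions hΓ hτ hC hφ
  rw [Set.mem_iUnion]
  exact ⟨⟨ψ, hψ⟩, φ z, hφz, hψφ z hzb⟩

/-- The union of the translates is almost all of the ball. -/
theorem ball_ae_eq_iUnion_image (hΓ : IsCongruenceSubgroup c H Γ') (hτ : ∀ x, τ₀ (c x) = conj (τ₀ x))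
    (hC : IsSylvester (H.map τ₀) C) {D : Set (Fin 2 → ℂ)} (hD : IsFundamentalDomainFor (ballActions τ₀ C Γ') D) :
    ball =ᵐ[(volume : Measure (Fin 2 → ℂ))] ⋃ φ : ballActions τ₀ C Γ', φ.1 '' D := by
  rw [ae_eq_set]
  refine ⟨?_, ?_⟩
  · have h := ae_mem_iUnion_image hΓ hτ hC hD
    rw [ae_restrict_iff' isOpen_ball.measurableSet] at h
    rw [ae_iff] at h
    refine measure_mono_null (fun z hz => ?_) h
    show ¬(z ∈ ball → z ∈ ⋃ φ : ballActions τ₀ C Γ', φ.1 '' D)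
    exact fun himp => hz.2 (himp hz.1)
  · have : (⋃ φ : ballActions τ₀ C Γ', φ.1 '' D) \ ball = ∅ := by
      rw [Set.sdiff_eq_empty, Set.iUnion_subset_iff]
      exact fun φ => image_subset_ball hΓ hτ hC φ.2 hD.2.1
    rw [this, measure_empty]

/-- **THE TILING**: `∫_𝔹 G = Σ'_φ ∫_{φ(D)} G` over `φ ∈ ballActions τ₀ C Γ′`, for `G` integrable on the ball. -/
theorem integral_ball_eq_tsum_image [NumberField E] (hΓ : IsCongruenceSubgroup c H Γ') (hτ : ∀ x, τ₀ (c x) = conj (τ₀ x))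
    (hC : IsSylvester (H.map τ₀) C) {D : Set (Fin 2 → ℂ)} (hD : IsFundamentalDomainFor (ballActions τ₀ C Γ') D)
    {G : (Fin 2 → ℂ) → ℂ} (hG : IntegrableOn G ball) :
    ∫ z in ball, G z = ∑' φ : ballActions τ₀ C Γ', ∫ z in φ.1 '' D, G z := by
  haveI : Countable (ballActions τ₀ C Γ') := countable_ballActions
  have hmeas : ∀ φ : ballActions τ₀ C Γ', MeasurableSet (φ.1 '' D) := by
    intro φ
    obtain ⟨M, hM, hφ⟩ := exists_unitaryJ_of_mem_ballActions hΓ hτ hC φ.2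
    rw [hφ]
    exact measurableSet_image_actM hM hD.1 hD.2.1
  have hsub : (⋃ φ : ballActions τ₀ C Γ', φ.1 '' D) ⊆ ball :=
    Set.iUnion_subset fun φ => image_subset_ball hΓ hτ hC φ.2 hD.2.1
  rw [setIntegral_congr_set (ball_ae_eq_iUnion_image hΓ hτ hC hD)]
  refine integral_iUnion_ae (fun φ => (hmeas φ).nullMeasurableSet) ?_ (hG.mono_set hsub)
  intro φ ψ hne
  exact hD.2.2.2 φ.1 φ.2 ψ.1 ψ.2 (fun h => hne (Subtype.ext h))

/-- **THE TILING, pulled back to `D`**: `∫_𝔹 G = Σ'_φ ∫_D |det Jac φ|² · G ∘ φ`, where for each `φ = actM M` the tile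
contributes `∫_D normSq (jacDetMap (actM M) z) · G (actM M z) dz`. -/
theorem integral_ball_eq_tsum_domain [NumberField E] (hΓ : IsCongruenceSubgroup c H Γ') (hτ : ∀ x, τ₀ (c x) = conj (τ₀ x))
    (hC : IsSylvester (H.map τ₀) C) {D : Set (Fin 2 → ℂ)} (hD : IsFundamentalDomainFor (ballActions τ₀ C Γ') D)
    {G : (Fin 2 → ℂ) → ℂ} (hG : IntegrableOn G ball) :
    ∫ z in ball, G z = ∑' φ : ballActions τ₀ C Γ',
      ∫ z in D, (Complex.normSq (jacDetMap φ.1 z) : ℂ) * G (φ.1 z) := by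
  rw [integral_ball_eq_tsum_image hΓ hτ hC hD hG]
  refine tsum_congr fun φ => ?_
  obtain ⟨M, hM, hφ⟩ := exists_unitaryJ_of_mem_ballActions hΓ hτ hC φ.2
  rw [hφ]
  exact integral_image_actM hM hD.1 hD.2.1 G

end Tiling

end Summit.Ventures.HodgeRepro.Tier4.Line3

end
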